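import Mathlib
import HarnessLib
import HarnessLib.Audit
import Summits.NavierStokesRegularity.Statement
import Literature.Analysis.FluidPDE.SuitableWeak
import Literature.Analysis.FluidPDE.AxisymmetricEuler
import Literature.Analysis.FluidPDE.ClassicalSolution
import Literature.Analysis.FluidPDE.LerayHopf
import Literature.Analysis.FluidPDE.SelfSimilarLiouville
import Summits.NavierStokesRegularity.NavierStokesRegularity.Theorems.NoBlowupToClay
import Summits.NavierStokesRegularity.NavierStokesRegularity.Theorems.AxisymmetricExtremalityAxisymmetricKatoGlobalStubSeregin2020TypeIIDischarge
import HarnessLib.Audit.Status.Attr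

/-!
Route: RootDecompAxisLogGauge

# Route RootDecompAxisLogGauge — Root decomposition g2 — Clay (A) ⟸ off-axis cell ∧ (AX ⟸ log-gauge
criterion ∧ log-gauge coverage) — the AxisLogGaugePincer node

ROOT DECOMPOSITION CELL decomp-ns (D-0178/D-0179, RESIDUAL MODE, blocker-first), generation 2,
route-writer decomp-ns-writer-1:
the critic-CLEARED lens-1 node AxisLogGaugePincer («grading / quantitative ladder»; CRITIC-LEDGER
rows 6 and 8, HOME/STATUS.md
CLEARED 2026-08-30T01:32:55Z «outer FREE SYMMETRY-CLASS SPLIT with the general cell DECLARED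
RESIDUAL + inner ONE-RUNG CARVING of the
axis cell AX (census C05) at gauge |ln r| — WRITER: book under TREE axis (i)/C05 as the cell's
SECOND root file»; lens file
HOME/decomp-ns-lens-1/AxisLogGaugePincer.lean rev1 sha256
7b074ee8abc63064dc1ab24385ece358ca8b5a121448f70e688d5f8207f9e0bf, lean rc 0 /
0 sorry / 0 warnings, kernel `closes`, `root_iff_pieces` (EXACT), `axisNoBlowup_of_pincer`, DESCENT
`gaugeCoverage_mono` /
`gaugeCriterion_anti`; census data file of record HOME/census/COSTUME-CENSUS-v2.json sha256
05830338dcd56dc85a60276b05d4c6d88311c06479f2f16e07487067c2455ac6 (rows C05, C16, E05, H18; HOME =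
run/shared/lean/pub/decomp-ns); TREE node
N2). TREE: ROOT `NavierStokesRegularity` (Clay (A)) ⟺[EQUIV E0, landed
`navierStokesRegularity_of_noBlowup` / `…_iff_noBlowup` — the cell's
one admissible equivalence] NoBlowup ⟸[AND, free symmetry-class split, seam = excluded middle on K =
«axisymmetric about SOME fixed axis on
[0,T)», rotation/translation-invariant] OffAxisNoBlowup (general cell, DECLARED RESIDUAL) ∧
AxisNoBlowup, and AxisNoBlowup (= AX, stmt-1964 /
C05, in blow-up language) ⟸[AND, the GAUGE PINCER `axisNoBlowup_of_pincer g` at g = |ln r|]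
LogGaugeCriterion (the ATTACKED jaw) ∧
LogGaugeCoverage (coverage jaw, DECLARED RESIDUAL). It suffices to show X = X1 ∧ X2 ∧ X3 with X1 =
OffAxisNoBlowup (no blow-up outside the
axisymmetric class), X2 = LogGaugeCriterion (an axisymmetric classical Leray–Hopf solution on [0,T)
whose CKN scaled energy E(r) =
r⁻¹∫∫_(Q_r(T,x0)) |∇u|² is O(|ln r|) at every point extends past T) and X3 = LogGaugeCoverage (every
axisymmetric maximal solution has E(r) =
O(|ln r|) at every point). X2 ∧ X3 is the g = |ln r| instance of a gauge-graded pincer Criterion(g)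
∧ Coverage(g) whose lower criterion
rungs g ≡ 1 (Type I: Seregin 2020 Thm 2.1 — KERNEL-PROVED in the tree,
`Theorems.AxisymmetricKatoGlobal.EulerScaling.
Seregin2020_axisymmetricSingularPoint_typeII_holds`, the BC5 witness) and g = (ln ln 1/r)^μ (Lei–Ren
2024 Thm 4, CTZ 2022 Thm 1.3) are
theorems; X ⟺ S exactly (free symmetry split + pincer, `root_iff_pieces`). Why this is novel: no
route of the census (COSTUME-CENSUS-v2.json
sha256 05830338dcd56dc85a60276b05d4c6d88311c06479f2f16e07487067c2455ac6, rows C05/C16) grades the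
axisymmetric cell of Clay (A) by a
scaled-energy GAUGE at blow-up points — the node promotes Lei–Ren's printed |ln r| question
(arXiv:2210.01783 p.6) to the criterion jaw of
an exact two-jaw split with kernel monotonicity in the gauge, so the a-priori side is an explicit
residual that weakens with every proved rung
(KnvAxisInflow/SwirlThreshold grade by swirl size or radial inflow, EulerZoomLiouville by POWER
gauges in the general class).
Lean: `OffAxisNoBlowup ∧ LogGaugeCriterion ∧ LogGaugeCoverage`

## Assembly
Pure logic (kernel-checked, 0 sorry): NoBlowup ⟹ Clay (A) is the landed theorem
navierStokesRegularity_of_noBlowup; given a classical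
Leray–Hopf solution on [0,T), either it is axisymmetric about some axis on [0,T) — then if it did
not extend it would be maximal, LogGaugeCoverage
gives the log-gauge bound at every point and LogGaugeCriterion extends it, contradiction — or it is
not, and OffAxisNoBlowup extends it.

Rationale: WHY THIS LINE. In the axisymmetric class Type-I blow-up is excluded (KNSS2009, SereginSverak2009;
Seregin 2020 Thm 2.1 = tree fact
Seregin2020_axisymmetricSingularPoint_typeII), so the scaled energy E(r) at an axisymmetric singular
point must be UNBOUNDED as r → 0;
the 2016–2024 slightly-supercritical criteria (Pan2016, seregin2022_logSwirl_regularAtOrigin,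
chenTsaiZhang2022_thm13_poloidalA,
Lei–Ren arXiv:2210.01783 Thm 4) push the excluded growth to (ln ln 1/r)^μ, and Lei–Ren (p. 6) name
the single-log gauge as the
open next step. The line grades the axisymmetric regularity problem (AX, stmt-1964, census C05) by
the GAUGE g of E(r) at blow-up
points and splits it into a criterion jaw (attackable: quantitative CKN epochs of regularity + the
swirl Hölder/log-modulus machinery of
Chen–Fang–Zhang / Lei–Zhang / Wei) and an a-priori coverage jaw (residual), with kernel monotonicity
in g so that each proved rung
re-instantiates the node with a strictly weaker residual. Imported area: parabolic ε-regularity /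
Campanato iteration (CKN, Lin) made
quantitative (Lei–Ren's "quantitative epochs of regularity"). No prior route grades AX by a
scaled-energy gauge: KnvAxisInflow (closed)
and SwirlThreshold grade by swirl size / radial inflow, EulerZoomLiouville by POWER gauges in the
general class.

RANKED CRUXES. #2 LogGaugeCriterion (crux) — LOG-GAUGE CRITERION [the ATTACKED jaw of the pincer;
tag WEAKER(evidence: S ⟹ it KERNEL `logGaugeCriterion_of_root` (vacuity through S → NoBlowup); it
does NOT give S — vacuous on every non-axisymmetric blow-up and on every axisymmetric blow-up whose
scaled energy outgrows C|ln r| (Seregin 2024 Euler-scaling axisymmetric Type-II scenario, tree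
`Seregin2024AxisymTypeIIScenario`; power-gauged profiles); the rungs below it are THEOREMS: g ≡ 1 =
Seregin 2020 Thm 2.1, KERNEL-PROVED in the tree
`Theorems.AxisymmetricKatoGlobal.EulerScaling.Seregin2020_axisymmetricSingularPoint_typeII_holds` (=
the BC5 witness: bounded scaled energy at an axisymmetric point ⇒ regular point, in the class where
AX is open), g = (ln ln 1/r)^μ = Lei–Ren 2024 Thm 4 [corpus:arxiv-2210.01783 p.6 L44–49] / CTZ 2022
Thm 1.3 (tree fact `chenTsaiZhang2022_thm13_poloidalA`) / Pan 2016 / Seregin 2022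
(`seregin2022_logSwirl_regularAtOrigin_holds`) — critic CLEARED 2026-08-30T01:32:55Z, CRITIC-LEDGER
rows 6, 8; BC7 CLEAN); leaf ATTACKABLE (= Lei–Ren's printed question p.6 L57–58; engine: Lei–Ren
quantitative epochs of regularity (Prop 17, log-growth lemma p.9) + swirl log-modulus CTZ Prop 1.2 /
Lei–Zhang 2017 / Wei 2016; BC3 skeleton Lines/birth.lean: stub_logGaugePointBounded (the
mathematics, L) + stub_extension_of_locallyBounded (continuation bookkeeping, M, in print) ⟹
`LogGaugeCriterion_of` kernel-checked) + INSTRUMENTABLE (T-instr: fit E(r;T,0) against the gauges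
{1, (lnln)^μ, |ln r|, r^(−β)} on a Hou-type axisymmetric run — census v2 row C16/H18: data not held,
regeneration out of budget, paper proxy UNDECIDED)] — for ν>0, T>0 and (u,p) classical NS on
ℝ³×[0,T), Leray–Hopf from the rapidly decaying slice u(0), axisymmetric about some axis on [0,T): if
at every x0 there are C, r0>0 with cknE r (T,x0) ∇u ≤ C·|ln r| for 0<r<r0, then u extends smoothly
past T. [difficulty: L] (why it might fail: the (ln ln)^μ proofs spend a full exponential on the
swirl log-modulus (CTZ Prop 1.2: |Γ| ≤ N e^(−c|ln r|^τ)); at gauge |ln r| the Lei–Zhang/Wei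
threshold |ln r|^(−3/2) may be exactly missed.) [arXiv:2210.01783, arXiv:2201.01766,
arXiv:2109.09344, Pan2016, arXiv:2604.07785]
#3 LogGaugeCoverage (crux) — LOG-GAUGE COVERAGE [DECLARED RESIDUAL = the coverage (a-priori) jaw of
the axisymmetric cell; it carries AX's supercritical gap (the free energy-inequality gauge r⁻¹ must
improve to |ln r| at axis points); tag WEAKER(evidence: S ⟹ it KERNEL `logGaugeCoverage_of_root`;
separating class NAMED and alive in print: the log-corrected nearly self-similar axisymmetric
blow-up — Hou 2022 arXiv:2107.06509 p.11–12 «possibly with a logarithmic correction», rate «most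
likely not exactly 1/2» p.12, Lei–Ren 2024 p.6 L14; NOT costume: no |ln r| criterion exists (census
A10 needs a PROVED criterion) — at grade g ≡ 1 this leg WOULD read «every axisymmetric blow-up is
Type I» ≡ AX by Seregin 2020, which is WHY the node is instantiated one logarithm up — critic
CLEARED rows 6, 8; BC7 CLEAN); leaf IDEA-NEEDED + BARRIER-adjacent
(Literature.Barriers.NavierStokesRegularity.EnergySupercriticality bites every ABSTRACT a-priori
argument above energy scaling; the bet is the axisymmetric structure: Γ = r·u_θ maximum principle,
CKN singular set ⊂ axis, KNSS no Type I) + INSTRUMENTABLE (T-instr as for the criterion; census v2: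
log-corrected self-similar ansatz ‖u‖∞√(T−t) ~ |ln(T−t)|^a gives E(r) ~ |ln r|^(2a), gauge holds iff
a ≤ 1/2 — UNDECIDED); never ATTACKABLE — not a prover target; DESCENT rule: when LogGaugeCriterion
closes, re-instantiate the pincer at a larger gauge — the new coverage residual is implied by this
one (`gaugeCoverage_mono`), strictly weaker per round] — for ν>0, T>0 and (u,p) a MAXIMAL smooth
solution on [0,T) (no smooth extension past T), Leray–Hopf from the rapidly decaying slice u(0),
axisymmetric about some axis on [0,T): at every x0 there are C, r0>0 with cknE r (T,x0) ∇u ≤ C·|ln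
r| for 0<r<r0. [difficulty: open-problem] (why it might fail: an axisymmetric blow-up with
super-logarithmic scaled-energy growth (Seregin's Euler-scaling Type-II scenario, 2024; a
power-gauged profile) would refute it; only the energy gauge r⁻¹ is a priori.) [arXiv:2107.06509,
arXiv:2210.01783, Seregin2024, KNSS2009]
#4 OffAxisNoBlowup (crux) — OFF-AXIS CELL [DECLARED RESIDUAL = the general cell of the FREE
symmetry-class split (K = axisymmetric about SOME fixed axis ∃(Q ≃ₗᵢ, c) on every slice of [0,T) —
rotation/translation-INVARIANT, so neither cell is killed by a symmetry of the other, critic T2/T5);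
tag WEAKER(evidence: S ⟹ it KERNEL `offAxisNoBlowup_of_root`; converse unknown — separating class =
axisymmetric blow-ups (Hou's interior scenario arXiv:2107.06509); it is S minus the OPEN problem
class AX (stmt-1964, census C05), not minus a proved class (census A14 does not apply) — critic
CLEARED rows 6, 8; BC7 CLEAN); leaf IDEA-NEEDED — zero currency claimed here: every general node of
the TREE (N1 RootDecompTerminalEnergy's terminal-energy lattice, the Type-I/Type-II frame, the
lens-3/lens-4 nodes) applies to this cell verbatim; not a prover target] — for ν>0, T>0 and (u,p)
classical NS on ℝ³×[0,T), Leray–Hopf from the rapidly decaying slice u(0), NOT axisymmetric about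
any axis on [0,T): u extends smoothly past T. [difficulty: open-problem] (why it might fail: it is
Clay (A) outside a nowhere-dense symmetry class: any non-axisymmetric blow-up (none known; Tao's
averaged cascade is not NS) refutes it; no attack is proposed here.) [Fefferman2000,
arXiv:2107.06509, arXiv:1402.0290]

TWO-LAYER PLAN. LogGaugeCriterion ⇐ PointLogRegular (local: suitable axisymmetric solution in Q_1
with E(r) ≤ C|ln r| at the axis point is regular there;
Lei–Ren Thm 4 shape) → FarFieldAndContinuation (bounded near every (T,x0) + Leray–Hopf decay ⇒
extends; LerayFarFieldEpsilonRegularity +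
classical continuation) → LogGaugeCriterion. After LogGaugeCriterion closes: re-instantiate the
pincer at g = |ln r|^μ (new criterion crux,
coverage residual strictly weaker by gaugeCoverage_mono).

KILL CRITERIA. A refutation of LogGaugeCoverage by an explicit axisymmetric blow-up is ¬AX hence ¬S
(route moot, summit decided negatively). A proof that
the |ln r| criterion is FALSE (a singular axisymmetric suitable solution with E(r) = O(|ln r|))
closes the route refuted:LogGaugeCriterion and
kills the whole gauge ladder above lnln. LogGaugeCriterion found in print ⇒ re-instantiate one gauge
up (not a kill). AX (1964/15453) proved
elsewhere ⇒ the inner pincer is moot and the route reduces to OffAxisNoBlowup (close superseded).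

NOT DECOMPOSED YET. The local ε-regularity form of the criterion (suitable weak, unit cylinder, axis
point) and its far-field/continuation glue; the swirl
log-modulus lemma at gauge |ln r| (CTZ Prop 1.2 analogue); intermediate gauges |ln r|^μ, 0<μ<1;
nothing under the two residuals.

CHEAPEST FALSIFIER. Lookup: is the single-log improved CKN criterion for axisymmetric suitable
solutions already a theorem (post-2024 follow-ups of
arXiv:2210.01783 / arXiv:2201.01766)? Searched 2026-08-30 (corpus fts+hybrid, galaxy, crossref):
newest held items arXiv:2604.07785 (Zhang 2026,
partial Type I; p.3 still cites |ln r|^(−2) / |ln r|^(−3/2) swirl moduli as the frontier) and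
arXiv:2508.19590 — no single-log scaled-energy
criterion found. Second: BC7 crux probes (P1–P5) on all three items — CLEAN (no cheap proof, no
vacuity, C → S not closable).

NUMBERS. Gauge ladder for E(r) = cknE r (T,x0) ∇u at an axisymmetric point: g ≡ 1 excluded-singular
(Seregin 2020 Thm 2.1; KNSS 2009); g = (ln ln 1/r)^μ,
μ < 1/150 (Lei–Ren 2024 Thm 4, p. 6), μ = 1/4 in the sup-form |u| ≤ C (ln ln 1/r)^(1/4)/r (Lei–Ren
Thm 3); swirl moduli |Γ| ≤ C|ln r|^(−2)
(Lei–Zhang 2017), |ln r|^(−3/2) (Wei 2016); a-priori: E(r) ≤ (2ν)⁻¹‖u0‖₂² · r⁻¹ (energy inequality).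
Hou 2022 candidate (arXiv:2107.06509
p. 11–12, 16): ‖u‖∞ ~ (T−t)^(−1/2), Z(t) ~ (T−t)^(1/2) "possibly with a logarithmic correction",
rate "most likely not exactly 1/2".

DEFINITION REQUESTS. None: cknE, IsAxisymmetric, IsClassicalNSSolutionOn, IsLerayHopfOn,
IsMaximalSmoothSolution, HasSmoothExtensionPast, HasRapidSpatialDecay exist.

Novelty: Searches (2026-08-30): lit search "axially symmetric Navier-Stokes swirl a priori logarithmic" (16
local docs, 0 with a log scaled-energy
a-priori bound); lit search --hybrid "a priori bound swirl axially symmetric Navier-Stokes near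
axis" ; lit search
"axisymmetric Navier-Stokes slightly supercritical regularity criterion logarithm" --year-from 2022
(16 local + 18 crossref; newest
arXiv:2604.07785, arXiv:2508.19590); rg over Theses/*.lean for cknE|IsAxisymmetric
(EulerZoomLiouville power gauges; HalfHolderEnergy,
HardyPointSink, LocalPressureProfileDoor general-class; KnvAxisInflow closed; SwirlThreshold
swirl-size); ledger negatives (5, none related).
Nearest prior art found: arXiv:2210.01783 (Lei–Ren 2024, Thm 4: (ln ln)^μ improved CKN criterion for
axisymmetric suitable solutions; p. 6 names
the |ln r| question); arXiv:2201.01766 (Chen–Tsai–Zhang 2022 Thm 1.3, tree fact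
chenTsaiZhang2022_thm13_poloidalA); in tree
EulerZoomLiouville.TypeIOrPowerZoomable (stmt-19833: power-gauged coverage, general class).
Delta: promotes Lei–Ren's printed open question to the criterion jaw of an exact, gauge-graded
two-jaw split of the axisymmetric cell with
kernel monotonicity in the gauge, so that the a-priori side is an explicit residual that weakens
with every proved rung.
Claimed grade: new-combination  [refs: 2604.07785, 2508.19590, 2210.01783, 2201.01766]

Barriers (technique_class: epsilon-regularity, axisymmetric-swirl, scaled-energy gauge): - technique_class: epsilon-regularity, axisymmetric-swirl, scaled-energy gauge
- Literature.Barriers.NavierStokesRegularity.EnergySupercriticality: the criterion jaw stays in the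
LOGARITHMIC window above the critical
  gauge where ε-regularity + the axisymmetric swirl structure (Γ maximum principle, CKN: singular
set ⊂ axis) already produced theorems
  (lnln rungs); power gauges r^(−β) are conceded to the barrier. The coverage jaw does not evade it;
the bet is the axisymmetric structure.
- Literature.Barriers.NavierStokesRegularity.TaoAveragedBlowup: Tao's averaged equation has no
axisymmetric structure / Γ maximum
  principle; every rung used (KNSS, CTZ, Lei–Ren) exploits the exact axisymmetric system, outside
the averaged class.
- Literature.Barriers.NavierStokesRegularity.AxisymmetricTypeIExclusion: used as the bottom rung (g
≡ 1), not contradicted: the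
  coverage jaw asks only for log growth, not Type I.
- Literature.Barriers.NavierStokesRegularity.NavierStokesInequalitySingularSolution: the pincer does
NOT strengthen CKN partial
  regularity by an argument valid for every suitable weak solution of the Navier–Stokes INEQUALITY
(Scheffer/Ozański singular NSI solutions):
  the criterion jaw uses the EQUATION through the axisymmetric swirl structure — Γ = r·u_θ maximum
principle, the no-swirl/2-D reductions of
  KNSS, the Lei–Ren / CTZ epochs-of-regularity bootstrap — none of which holds in the NSI class; the
coverage jaw is a statement about
  solutions of the equation, unt

sub-problem: NavierStokesRegularity · status: open · opened planner-decomp-ns-writer-1-g2-0 2026-08-30T02:33:25Z · rev 0 · ledger route-NavierStokesRegularity-RootDecompAxisLogGauge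
GENERATED by the gate from the ledger (D-0016/17). Provers cite these decls: `theorem foo : Summit.NavierStokesRegularity.NavierStokesRegularity.Theses.RootDecompAxisLogGauge.<Decl> := …` in Summits/NavierStokesRegularity/NavierStokesRegularity/Theorems/<Name>.lean.
-/

namespace Summit.NavierStokesRegularity.NavierStokesRegularity.Theses.RootDecompAxisLogGauge

open scoped BigOperators Topology Manifold Classical MeasureTheory ProbabilityTheory Matrix InnerProductSpace ComplexConjugate ContinuousMap
open Filter Set Function TopologicalSpace MeasureTheory

attribute [summit_statement] _root_.NavierStokesRegularity

open Literature.NS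

/-- item stmt-NavierStokesRegularity-25378 · crux · rank 2 · open · by planner
why it might fail: the (ln ln)^μ proofs spend a full exponential on the swirl log-modulus (CTZ Prop 1.2: |Γ| ≤ N e^(−c|ln r|^τ)); at gauge |ln r| the Lei–Zhang/Wei threshold |ln r|^(−3/2) may be exactly missed.
sources: arXiv:2210.01783, arXiv:2201.01766, arXiv:2109.09344, Pan2016, arXiv:2604.07785
[crux] LOG-GAUGE CRITERION [the ATTACKED jaw of the pincer; tag WEAKER(evidence: S ⟹ it KERNEL
`logGaugeCriterion_of_root` (vacuity through S → NoBlowup); it does NOT give S — vacuous on every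
non-axisymmetric blow-up and on every axisymmetric blow-up whose scaled energy outgrows C|ln r|
(Seregin 2024 Euler-scaling axisymmetric Type-II scenario, tree `Seregin2024AxisymTypeIIScenario`;
power-gauged profiles); the rungs below it are THEOREMS: g ≡ 1 = Seregin 2020 Thm 2.1, KERNEL-PROVED
in the tree
`Theorems.AxisymmetricKatoGlobal.EulerScaling.Seregin2020_axisymmetricSingularPoint_typeII_holds` (=
the BC5 witness: bounded scaled energy at an axisymmetric point ⇒ regular point, in the class where
AX is open), g = (ln ln 1/r)^μ = Lei–Ren 2024 Thm 4 [corpus:arxiv-2210.01783 p.6 L44–49] / CTZ 2022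
Thm 1.3 (tree fact `chenTsaiZhang2022_thm13_poloidalA`) / Pan 2016 / Seregin 2022
(`seregin2022_logSwirl_regularAtOrigin_holds`) — critic CLEARED 2026-08-30T01:32:55Z, CRITIC-LEDGER
rows 6, 8; BC7 CLEAN); leaf ATTACKABLE (= Lei–Ren's printed question p.6 L57–58; engine: Lei–Ren
quantitative epochs of regularity (Prop 17, log-growth lemma p.9) + swirl log-modulus CTZ Prop 1.2 /
Lei–Zhang 2017 / W -/
@[route_item "route-NavierStokesRegularity-RootDecompAxisLogGauge", crux]
def LogGaugeCriterion : Prop :=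
  ∀ (ν T : ℝ), 0 < ν → 0 < T → ∀ (u : ℝ → EuclideanSpace ℝ (Fin 3) → EuclideanSpace ℝ (Fin 3)) (p : ℝ → EuclideanSpace ℝ (Fin 3) → ℝ), Literature.Analysis.FluidPDE.IsClassicalNSSolutionOn (Set.Ico 0 T) ν 0 u p → Literature.Analysis.FluidPDE.IsLerayHopfOn T ν 0 (u 0) u → Literature.Analysis.FluidPDE.HasRapidSpatialDecay (u 0) → (∃ (Q : EuclideanSpace ℝ (Fin 3) ≃ₗᵢ[ℝ] EuclideanSpace ℝ (Fin 3)) (c : EuclideanSpace ℝ (Fin 3)), ∀ t ∈ Set.Ico 0 T, Literature.Analysis.FluidPDE.IsAxisymmetric (fun y => Q.symm (u t (c + Q y)))) → (∀ x₀ : EuclideanSpace ℝ (Fin 3), ∃ C r₀ : ℝ, 0 < r₀ ∧ ∀ r ∈ Set.Ioo 0 r₀, Literature.Analysis.FluidPDE.cknE r ((T, x₀) : ℝ × EuclideanSpace ℝ (Fin 3)) (fun t x => fderiv ℝ (u t) x) ≤ ENNReal.ofReal (C * |Real.log r|)) → Literature.Analysis.FluidPDE.HasSmoothExtensionPast ν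 0 u T

/-- item stmt-NavierStokesRegularity-25379 · crux · rank 3 · open · by planner
why it might fail: an axisymmetric blow-up with super-logarithmic scaled-energy growth (Seregin's Euler-scaling Type-II scenario, 2024; a power-gauged profile) would refute it; only the energy gauge r⁻¹ is a priori.
sources: arXiv:2107.06509, arXiv:2210.01783, Seregin2024, KNSS2009
[crux] LOG-GAUGE COVERAGE [DECLARED RESIDUAL = the coverage (a-priori) jaw of the axisymmetric cell;
it carries AX's supercritical gap (the free energy-inequality gauge r⁻¹ must improve to |ln r| at
axis points); tag WEAKER(evidence: S ⟹ it KERNEL `logGaugeCoverage_of_root`; separating class NAMED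
and alive in print: the log-corrected nearly self-similar axisymmetric blow-up — Hou 2022
arXiv:2107.06509 p.11–12 «possibly with a logarithmic correction», rate «most likely not exactly
1/2» p.12, Lei–Ren 2024 p.6 L14; NOT costume: no |ln r| criterion exists (census A10 needs a PROVED
criterion) — at grade g ≡ 1 this leg WOULD read «every axisymmetric blow-up is Type I» ≡ AX by
Seregin 2020, which is WHY the node is instantiated one logarithm up — critic CLEARED rows 6, 8; BC7
CLEAN); leaf IDEA-NEEDED + BARRIER-adjacent
(Literature.Barriers.NavierStokesRegularity.EnergySupercriticality bites every ABSTRACT a-priori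
argument above energy scaling; the bet is the axisymmetric structure: Γ = r·u_θ maximum principle,
CKN singular set ⊂ axis, KNSS no Type I) + INSTRUMENTABLE (T-instr as for the criterion; census v2:
log-corrected self-similar ansatz ‖u‖∞√(T−t) ~ |ln(T−t)|^a gives E(r) ~ |ln r| -/
@[route_item "route-NavierStokesRegularity-RootDecompAxisLogGauge", crux]
def LogGaugeCoverage : Prop :=
  ∀ (ν T : ℝ), 0 < ν → 0 < T → ∀ (u : ℝ → EuclideanSpace ℝ (Fin 3) → EuclideanSpace ℝ (Fin 3)) (p : ℝ → EuclideanSpace ℝ (Fin 3) → ℝ), Literature.Analysis.FluidPDE.IsMaximalSmoothSolution ν 0 u p T → Literature.Analysis.FluidPDE.IsLerayHopfOn T ν 0 (u 0) u → Literature.Analysis.FluidPDE.HasRapidSpatialDecay (u 0) → (∃ (Q : EuclideanSpace ℝ (Fin 3) ≃ₗᵢ[ℝ] EuclideanSpace ℝ (Fin 3)) (c : EuclideanSpace ℝ (Fin 3)), ∀ t ∈ Set.Ico 0 T, Literature.Analysis.FluidPDE.IsAxisymmetric (fun y => Q.symm (u t (c + Q y)))) → ∀ x₀ : EuclideanSpace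 ℝ (Fin 3), ∃ C r₀ : ℝ, 0 < r₀ ∧ ∀ r ∈ Set.Ioo 0 r₀, Literature.Analysis.FluidPDE.cknE r ((T, x₀) : ℝ × EuclideanSpace ℝ (Fin 3)) (fun t x => fderiv ℝ (u t) x) ≤ ENNReal.ofReal (C * |Real.log r|)

/-- item stmt-NavierStokesRegularity-25380 · crux · rank 4 · open · by planner
why it might fail: it is Clay (A) outside a nowhere-dense symmetry class: any non-axisymmetric blow-up (none known; Tao's averaged cascade is not NS) refutes it; no attack is proposed here.
sources: Fefferman2000, arXiv:2107.06509, arXiv:1402.0290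
[crux] OFF-AXIS CELL [DECLARED RESIDUAL = the general cell of the FREE symmetry-class split (K =
axisymmetric about SOME fixed axis ∃(Q ≃ₗᵢ, c) on every slice of [0,T) —
rotation/translation-INVARIANT, so neither cell is killed by a symmetry of the other, critic T2/T5);
tag WEAKER(evidence: S ⟹ it KERNEL `offAxisNoBlowup_of_root`; converse unknown — separating class =
axisymmetric blow-ups (Hou's interior scenario arXiv:2107.06509); it is S minus the OPEN problem
class AX (stmt-1964, census C05), not minus a proved class (census A14 does not apply) — critic
CLEARED rows 6, 8; BC7 CLEAN); leaf IDEA-NEEDED — zero currency claimed here: every general node of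
the TREE (N1 RootDecompTerminalEnergy's terminal-energy lattice, the Type-I/Type-II frame, the
lens-3/lens-4 nodes) applies to this cell verbatim; not a prover target] — for ν>0, T>0 and (u,p)
classical NS on ℝ³×[0,T), Leray–Hopf from the rapidly decaying slice u(0), NOT axisymmetric about
any axis on [0,T): u extends smoothly past T. [difficulty: open-problem] -/
@[route_item "route-NavierStokesRegularity-RootDecompAxisLogGauge", crux]
def OffAxisNoBlowup : Prop :=
  ∀ (ν T : ℝ), 0 < ν → 0 < T → ∀ (u : ℝ → EuclideanSpace ℝ (Fin 3) → EuclideanSpace ℝ (Fin 3)) (p : ℝ → EuclideanSpace ℝ (Fin 3) → ℝ), Literature.Analysis.FluidPDE.IsClassicalNSSolutionOn (Set.Ico 0 T) ν 0 u p → Literature.Analysis.FluidPDE.IsLerayHopfOn T ν 0 (u 0) u → Literature.Analysis.FluidPDE.HasRapidSpatialDecay (u 0) → ¬ (∃ (Q : EuclideanSpace ℝ (Fin 3) ≃ₗᵢ[ℝ] EuclideanSpace ℝ (Fin 3)) (c : EuclideanSpace ℝ (Fin 3)), ∀ t ∈ Set.Ico 0 T, Literature.Analysis.FluidPDE.IsAxisymmetric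 (fun y => Q.symm (u t (c + Q y)))) → Literature.Analysis.FluidPDE.HasSmoothExtensionPast ν 0 u T

/-- item stmt-NavierStokesRegularity-25381 · assembly · rank 1 · open · by planner
sources: Fefferman2000, CKN1982
[assembly] OffAxisNoBlowup → LogGaugeCriterion → LogGaugeCoverage → NavierStokesRegularity. -/
@[route_item "route-NavierStokesRegularity-RootDecompAxisLogGauge"]
def Assembly : Prop :=
  OffAxisNoBlowup → LogGaugeCriterion → LogGaugeCoverage → NavierStokesRegularity

/-! D-0027 §2.1 — DECIDING THEOREM (planner-authored via `route open/edit --closes-file`; by planner-decomp-ns-writer-1-g2-0 2026-08-30T02:33:25Z):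
its hypotheses are this route's items and its conclusion the sub-problem Statement (glue_lint), and it elaborates with this file. -/

@[closes "route-NavierStokesRegularity-RootDecompAxisLogGauge"] theorem closes (h₁ : OffAxisNoBlowup) (h₂ : LogGaugeCriterion) (h₃ : LogGaugeCoverage) :
    NavierStokesRegularity := by
  refine Summit.NavierStokesRegularity.NavierStokesRegularity.Theorems.navierStokesRegularity_of_noBlowup ?_
  intro ν T hν hT u p hc hl hd
  by_cases hK : ∃ (Q : EuclideanSpace ℝ (Fin 3) ≃ₗᵢ[ℝ] EuclideanSpace ℝ (Fin 3)) (c : EuclideanSpace ℝ (Fin 3)),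
      ∀ t ∈ Set.Ico 0 T, Literature.Analysis.FluidPDE.IsAxisymmetric (fun y => Q.symm (u t (c + Q y)))
  · by_contra hext
    exact hext (h₂ ν T hν hT u p hc hl hd hK (h₃ ν T hν hT u p ⟨hc, hext⟩ hl hd hK))
  · exact h₁ ν T hν hT u p hc hl hd hK

end Summit.NavierStokesRegularity.NavierStokesRegularity.Theses.RootDecompAxisLogGauge
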